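import Literature.Computability.Complexity.IPOptimumTree
import Literature.Computability.Complexity.CodeFPBudgets
import Literature.Computability.Complexity.CodeFPLists
import Literature.Computability.Complexity.CodeFPListKit
import Literature.Computability.Complexity.CodeFPStrings
import Literature.Computability.Complexity.CodeFPStringKit
import Literature.Computability.Complexity.StringCopy
import HarnessLib

/-!
# `IP ⊆ PSPACE`, machine layer I: the leaf test of the optimum-prover tree in polynomial time

The depth-first evaluation of the optimum prover (`SumMaxTreeDFS.lean`, `IPOptimumTree.lean`;
Arora–Barak §8.1.1 remark 2 / Exercise 8.1(b)) performs, per step, one of finitely many cheap updates;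
the only substantial one is the LEAF TEST `IPVerifier.leafTest V x m ℓ h r` — replay the verifier's
next-message function on the even positions of the history read off the child indices `h` (messages
`natBits m hᵢ`) with the coins `natBits ℓ r`, and ask the verdict. This file computes it on codes with
the typed combinators of `CodeFP.lean`, for a polynomial-time verifier (`V.next ∈ FP`,
`V.verdict ∈ P`):

* `natBitsC` (`natBits n a` as the list of the bits `a / 2^j % 2`, `natBits_eq_map_range`),
  `viewC`, `vmsgC` (padding by `CodeFP.takeD` of `CodeFPStringKit.lean`), `consistentBC`, **`leafTestC`**.

All proved; no named facts.

## References

* S. Arora, B. Barak, *Computational Complexity: A Modern Approach*, CUP 2009, §8.1.1 (remark 2),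
  Exercise 8.1(b), Def. 8.6, §1.3.
-/

noncomputable section

namespace Literature.Computability.Complexity

open _root_.Computability Polynomial Brick CodeFP

open scoped Classical

namespace IPVerifier

/-! ### Fixed-width numerals on codes -/

/-- `natBits n a` lists the bits `[a / 2^j is odd]`, `j < n`. [folklore] -/
theorem natBits_eq_map_range : ∀ (n a : ℕ), natBits n a = (List.range n).map fun j => decide (a / 2 ^ j % 2 = 1)
  | 0, _ => rfl
  | n + 1, a => by
    rw [natBits, List.range_succ_eq_map, List.map_cons, List.map_map, natBits_eq_map_range n (a / 2)]
    simp only [pow_zero, Nat.div_one]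
    congr 1
    refine List.map_congr_left fun j _ => ?_
    simp only [Function.comp_apply, pow_succ', ← Nat.div_div_eq_div_mul]

/-- **`natBits` on codes**: `(1ⁿ, a) ↦ natBits n a`. [folklore] -/
theorem natBitsC : CodeFP (pairE unE natE) strE (fun p => natBits p.1 p.2) := by
  have hj : CodeFP (pairE (pairE unE natE) natE) unE (fun t => min t.2 t.1.1) := (unOfNatMin.comp ((fst _ _).fst'.pair (snd _ _)) :)
  have hpow : CodeFP (pairE (pairE unE natE) natE) natE (fun t => 2 ^ min t.2 t.1.1) := (natPow.comp ((const _ 2).pair hj) :)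
  have hbit : CodeFP (pairE (pairE unE natE) natE) bitE (fun t => decide (t.1.2 / 2 ^ min t.2 t.1.1 % 2 = 1)) :=
    (natEq.comp ((natMod.comp ((natDiv.comp ((fst _ _).snd'.pair hpow)).pair (const _ 2))).pair (const _ 1)) :)
  have hmap := map (σ := ℕ × ℕ) (α := ℕ) (eσ := pairE unE natE) (eα := natE) (eβ := bitE) hbit
  have hlist : CodeFP (pairE unE natE) (rawE bitE) (fun p => (List.range p.1).map fun j => decide (p.2 / 2 ^ min j p.1 % 2 = 1)) :=
    (hmap.comp ((CodeFP.id _).pair (urange.comp (fst _ _))) :)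
  refine ((bitsToStr.comp hlist).congr fun p => ?_ :)
  rw [natBits_eq_map_range]
  refine (List.map_congr_left fun j hj => ?_).symm
  rw [min_eq_left (List.mem_range.1 hj).le]

/-! ### The verifier's message on codes -/

/-- The view `⟨x, ⟨r, enc msgs⟩⟩` is a typed code. [cite: AroraBarakCC2009, Def. 8.6] -/
theorem view_eq (x r : List Bool) (t : List (List Bool)) : view x r t = boolPair x (boolPair r (listE strE t)) := by
  rw [view, show ((encodingList Bool).listBool.encode t : List Bool) = listE strE t from congrFun (listE_eq (encodingList Bool)) t]

/-- **The view on codes**: `(x, r, msgs) ↦ view x r msgs`. [cite: AroraBarakCC2009, Def. 8.6] -/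
theorem viewC : CodeFP (pairE strE (pairE strE (rawE strE))) strE (fun t => view t.1 t.2.1 t.2.2) := by
  have h : CodeFP (pairE strE (pairE strE (rawE strE))) (pairE strE (pairE strE (listE strE))) (fun t => (t.1, t.2.1, t.2.2)) :=
    ((fst _ _).pair ((snd _ _).fst'.pair ((listOfRaw strE).comp (snd _ _).snd')) :)
  exact (h.recodeOut (eγ := strE) (g' := fun t => view t.1 t.2.1 t.2.2) fun t => by rw [view_eq]; rfl :)

variable (V : IPVerifier)

/-- **The verifier's message on codes**: `((x, 1ᵐ), (r, msgs)) ↦ vmsg x m r msgs`, for `V.next ∈ FP`.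
[cite: AroraBarakCC2009, Def. 8.6] -/
theorem vmsgC (hnext : V.next ∈ FP) :
    CodeFP (pairE (pairE strE unE) (pairE strE (rawE strE))) strE (fun t => V.vmsg t.1.1 t.1.2 t.2.1 t.2.2) := by
  have hnextC : CodeFP strE strE V.next := of_fn V.next hnext fun _ => rfl
  have hview : CodeFP (pairE (pairE strE unE) (pairE strE (rawE strE))) strE (fun t => view t.1.1 t.2.1 t.2.2) :=
    (viewC.comp ((fst _ _).fst'.pair (snd _ _)) :)
  have h : CodeFP (pairE (pairE strE unE) (pairE strE (rawE strE))) strE (fun t => (V.next (view t.1.1 t.2.1 t.2.2)).takeD t.1.2 false) :=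
    (CodeFP.takeD.comp ((fst _ _).snd'.pair (hnextC.comp hview)) :)
  exact h.congr fun t => rfl

/-! ### Consistency and the leaf test on codes -/

/-- **The consistency test on codes**: `((x, 1ᵐ), (r, msgs)) ↦ consistentB x m r msgs`. [cite: AroraBarakCC2009, Def. 8.6] -/
theorem consistentBC (hnext : V.next ∈ FP) :
    CodeFP (pairE (pairE strE unE) (pairE strE (rawE strE))) bitE (fun t => V.consistentB t.1.1 t.1.2 t.2.1 t.2.2) := by
  -- the per-position predicate, context `((x, m), (r, msgs))`, item `i`
  have hi : CodeFP (pairE (pairE (pairE strE unE) (pairE strE (rawE strE))) natE) natE (fun u => u.2) := snd _ _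
  have hmsgs : CodeFP (pairE (pairE (pairE strE unE) (pairE strE (rawE strE))) natE) (rawE strE) (fun u => u.1.2.2) := (fst _ _).snd'.snd'
  have heven : CodeFP (pairE (pairE (pairE strE unE) (pairE strE (rawE strE))) natE) bitE (fun u => u.2 % 2 == 0) :=
    ((beq natE_injective).comp ((natMod.comp (hi.pair (const _ 2))).pair (const _ 0)) :)
  have hget : CodeFP (pairE (pairE (pairE strE unE) (pairE strE (rawE strE))) natE) strE (fun u => u.1.2.2.getD u.2 []) :=
    ((rawGetD strE (d := ([] : List Bool)) rfl).comp (hmsgs.pair hi) :)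
  have htake : CodeFP (pairE (pairE (pairE strE unE) (pairE strE (rawE strE))) natE) (rawE strE) (fun u => u.1.2.2.take u.2) :=
    ((rawTakeNat strE).comp (hi.pair hmsgs) :)
  have hv : CodeFP (pairE (pairE (pairE strE unE) (pairE strE (rawE strE))) natE) strE
      (fun u => V.vmsg u.1.1.1 u.1.1.2 u.1.2.1 (u.1.2.2.take u.2)) :=
    ((V.vmsgC hnext).comp ((fst _ _).fst'.pair ((fst _ _).snd'.fst'.pair htake)) :)
  have heq : CodeFP (pairE (pairE (pairE strE unE) (pairE strE (rawE strE))) natE) bitE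
      (fun u => u.1.2.2.getD u.2 [] == V.vmsg u.1.1.1 u.1.1.2 u.1.2.1 (u.1.2.2.take u.2)) :=
    ((beq (eα := strE) (fun a b h => h)).comp (hget.pair hv) :)
  have hpred : CodeFP (pairE (pairE (pairE strE unE) (pairE strE (rawE strE))) natE) bitE
      (fun u => !(u.2 % 2 == 0) || (u.1.2.2.getD u.2 [] == V.vmsg u.1.1.1 u.1.1.2 u.1.2.1 (u.1.2.2.take u.2))) :=
    heven.not.or heq
  have hall := all hpred
  have hlen : CodeFP (pairE (pairE strE unE) (pairE strE (rawE strE))) (rawE natE) (fun t => List.range t.2.2.length) :=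
    (urange.comp ((ulength strE).comp (snd _ _).snd') :)
  exact ((hall.comp ((CodeFP.id _).pair hlen)).congr fun t => rfl :)

/-- The Boolean indicator of a language on a member. [folklore] -/
theorem boolIndicator_of_mem {L : Language Bool} {v : List Bool} (h : v ∈ L) : Set.boolIndicator L v = true := if_pos h

/-- The Boolean indicator of a language on a non-member. [folklore] -/
theorem boolIndicator_of_not_mem {L : Language Bool} {v : List Bool} (h : v ∉ L) : Set.boolIndicator L v = false := if_neg h

/-- **The leaf test on codes**: `((x, 1ᵐ, 1ˡ), (h, r)) ↦ leafTest x m ℓ h r`, for a polynomial-time verifier.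
[cite: AroraBarakCC2009, §8.1.1 (remark 2: each leaf is evaluated in polynomial time)] -/
theorem leafTestC (hV : V.IsPolyTime) :
    CodeFP (pairE (pairE strE (pairE unE unE)) (pairE (rawE natE) natE)) bitE
      (fun t => V.leafTest t.1.1 t.1.2.1 t.1.2.2 t.2.1 t.2.2) := by
  obtain ⟨hnext, hverd⟩ := hV
  -- the verdict as a typed bit
  have hχ : CodeFP strE bitE (fun v => decide (v ∈ V.verdict)) :=
    of_fn _ (indicatorFn_mem_FP hverd) fun v => by
      by_cases h : v ∈ V.verdict
      · calc encodeBool (Set.boolIndicator V.verdict (strE v)) = encodeBool true := congrArg encodeBool (boolIndicator_of_mem h)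
          _ = bitE (decide (v ∈ V.verdict)) := by rw [decide_eq_true h]; rfl
      · calc encodeBool (Set.boolIndicator V.verdict (strE v)) = encodeBool false := congrArg encodeBool (boolIndicator_of_not_mem h)
          _ = bitE (decide (v ∈ V.verdict)) := by rw [decide_eq_false h]; rfl
  have hx : CodeFP (pairE (pairE strE (pairE unE unE)) (pairE (rawE natE) natE)) strE (fun t => t.1.1) := (fst _ _).fst'
  have hm : CodeFP (pairE (pairE strE (pairE unE unE)) (pairE (rawE natE) natE)) unE (fun t => t.1.2.1) := (fst _ _).snd'.fst'
  have hl : CodeFP (pairE (pairE strE (pairE unE unE)) (pairE (rawE natE) natE)) unE (fun t => t.1.2.2) := (fst _ _).snd'.snd'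
  have hr : CodeFP (pairE (pairE strE (pairE unE unE)) (pairE (rawE natE) natE)) strE (fun t => natBits t.1.2.2 t.2.2) :=
    (natBitsC.comp (hl.pair (snd _ _).snd') :)
  have hmsgs : CodeFP (pairE (pairE strE (pairE unE unE)) (pairE (rawE natE) natE)) (rawE strE) (fun t => t.2.1.map (natBits t.1.2.1)) :=
    ((map (σ := ℕ) (α := ℕ) (eσ := unE) (eα := natE) (eβ := strE) natBitsC).comp (hm.pair (snd _ _).fst') :)
  have hcons : CodeFP (pairE (pairE strE (pairE unE unE)) (pairE (rawE natE) natE)) bitE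
      (fun t => V.consistentB t.1.1 t.1.2.1 (natBits t.1.2.2 t.2.2) (t.2.1.map (natBits t.1.2.1))) :=
    ((V.consistentBC hnext).comp ((hx.pair hm).pair (hr.pair hmsgs)) :)
  have hacc : CodeFP (pairE (pairE strE (pairE unE unE)) (pairE (rawE natE) natE)) bitE
      (fun t => decide (view t.1.1 (natBits t.1.2.2 t.2.2) (t.2.1.map (natBits t.1.2.1)) ∈ V.verdict)) :=
    (hχ.comp (viewC.comp (hx.pair (hr.pair hmsgs))) :)
  exact ((hcons.and hacc).congr fun t => rfl :)

end IPVerifier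

end Literature.Computability.Complexity

end
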